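import Summits.Parity.GeneralizedHardyLittlewood.Theorems.FordMaynardNoSieveConst0164NegWitness0164HalfValue
import Summits.Parity.GeneralizedHardyLittlewood.Theorems.FordMaynardNoSieveConst0164NegWitness0164LinnikFour

/-!
# Route `FordMaynardNoSieveConst0164`, crux `NegWitness0164` (stmt-Parity-19102), line `birth`,
# stub `stub_tweakNeg0164`: the two binding (fsl) families `f_{1,1}` and `f_{2,1}`, term by term

Helper file toward the certificate stub (K. Ford, J. Maynard, *On the theory of prime producing sieves*,
arXiv:2407.14368, §8, proof of Theorem 2.7 (c)).  For witnesses of the Ford–Maynard / class-R shape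
(`F₀⁽³⁾, F₀⁽⁴⁾ ∈ [-1, 0]`, `F₀⁽⁵⁾ ≥ 0` vanishing at vectors with a pair `≥ 1/2`, `F₀⁽⁶⁾ = 0`, support in
`{ξᵢ ≥ 41/250, Σ ξ = 1}`), with `α = 1 - |b| ≥ 1/2`:

* `family_one_eq_0164` — `f_{1,1}(b, α)/α = N₂ + N₃ + N₄` (pieces `n = 2, 3, 4`; `n = 5` meets `F₀⁽⁶⁾ = 0`,
  `n = 6` has no support), `family_two_eq_0164` — `f_{2,1}(b, α)/α = A + B` (pieces `n = 2, 3`);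
* signs: `blockWeight_half_two_nonpos_of_ge` (`w₂ ≤ 0` on `Δ₂(α)`, `α ≥ 1/2`), hence the `n = 2` terms are
  `≥ 0` when `F₀⁽³⁾ ≤ 0`, `F₀⁽⁴⁾ ≤ 0` (`N2_nonneg_0164`, `A_nonneg_0164` — Ford–Maynard's `F₃(α), F₄(α) ≥ 0`);
  `N4_nonneg_0164` — the `n = 4` term of `f_{1,1}` is `≥ 0` ("if `k = 4` and `f_{5,0}(1-α,u) ≠ 0` then
  `𝓛_{1/2}(u) = 3`");
* `hsmall_of_shape_0164` — hypothesis (ii) (`F₀ ≥ -1` at small vectors) from the shape;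
* `stub_tweakNeg0164_of_shape'` — **the stub from the shape plus three numerical inequalities**:
  (i) `T₃(F₀) + S₅(F₀) < -1`, (iv₁) `α (N₂ + N₃) ≥ -1` for `b ∈ [ν, 1/2)^1`, (iv₂) `α (A + B) ≥ -1` for
  `b ∈ [ν, 1/2)^2`, `|b| ≤ 1/2` (hypotheses (ii), (iii) and the families `s ≥ 3` being discharged).

Def-free.  References: [FordMaynard2024PrimeSieves] arXiv:2407.14368, §8 (proof of Theorem 2.7 (c)).
-/

noncomputable section

open Finset MeasureTheory Set
open scoped Classical
open Literature.Combinatorics.Enumerative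
open Literature.NumberTheory.Sieve Literature.NumberTheory.Sieve.FordMaynard

namespace Summit.Parity.GeneralizedHardyLittlewood.FordMaynardNoSieveConst0164NegWitness0164

/-- A slice term whose data factor vanishes identically is zero. [folklore] -/
theorem sliceIntegral_family_term_eq_zero {n m : ℕ} (α : ℝ) {F₀ : VecFn} {s : ℕ} (b : Fin s → ℝ)
    (hm : n + s = m) (hz : ∀ x : Fin m → ℝ, F₀ m x = 0) :
    sliceIntegral n α (fun v => if ∀ t, (41 / 250 : ℝ) ≤ v t then
      blockWeight (1 / 2) n v * F₀ (n + s) (Fin.append v b) else 0) = 0 := by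
  have hz' : ∀ v : Fin n → ℝ, F₀ (n + s) (Fin.append v b) = 0 := fun v => by
    rw [VecFn.apply_congr F₀ hm (Fin.append v b) (Fin.append v b ∘ Fin.cast hm.symm) fun i =>
      congrArg (Fin.append v b) (Fin.ext rfl)]
    exact hz _
  simp only [hz', mul_zero, ite_self, sliceIntegral_zero]

/-- **`f_{1,1}(b, α)/α` has three pieces** (`n = 2, 3, 4`) for data with `F₀⁽⁶⁾ = 0` supported on
`{ξᵢ ≥ 41/250, Σ ξ = 1}`. [cite: FordMaynard2024PrimeSieves, §8 ("f_{1,1}(1−α,α) ≥ F₃(α)+F₄(α)")] -/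
theorem family_one_eq_0164 {F₀ : VecFn}
    (hsupp : ∀ (k : ℕ) (ξ : Fin k → ℝ), F₀ k ξ ≠ 0 → (∀ i, (41 / 250 : ℝ) ≤ ξ i) ∧ ∑ i, ξ i = 1)
    (h6 : ∀ x : Fin 6 → ℝ, F₀ 6 x = 0) (α : ℝ) (b : Fin 1 → ℝ) :
    ∑ n ∈ Finset.Icc 2 6, sliceIntegral n α (fun v => if ∀ t, (41 / 250 : ℝ) ≤ v t then
        blockWeight (1 / 2) n v * F₀ (n + 1) (Fin.append v b) else 0) =
      sliceIntegral 2 α (fun v => if ∀ t, (41 / 250 : ℝ) ≤ v t then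
          blockWeight (1 / 2) 2 v * F₀ (2 + 1) (Fin.append v b) else 0) +
        sliceIntegral 3 α (fun v => if ∀ t, (41 / 250 : ℝ) ≤ v t then
          blockWeight (1 / 2) 3 v * F₀ (3 + 1) (Fin.append v b) else 0) +
        sliceIntegral 4 α (fun v => if ∀ t, (41 / 250 : ℝ) ≤ v t then
          blockWeight (1 / 2) 4 v * F₀ (4 + 1) (Fin.append v b) else 0) := by
  rw [show Finset.Icc 2 6 = {2, 3, 4, 5, 6} from by decide, Finset.sum_insert (by decide),
    Finset.sum_insert (by decide), Finset.sum_insert (by decide), Finset.sum_pair (by decide),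
    sliceIntegral_family_term_eq_zero α b (show 5 + 1 = 6 from rfl) h6,
    sliceIntegral_family_term_eq_zero α b (show 6 + 1 = 7 from rfl)
      (fun x => apply_eq_zero_of_seven_le_0164 hsupp (le_refl 7) x)]
  ring

/-- **`f_{2,1}(b, α)/α` has two pieces** (`n = 2, 3`) for data with `F₀⁽⁶⁾ = 0` supported on
`{ξᵢ ≥ 41/250, Σ ξ = 1}`. [cite: FordMaynard2024PrimeSieves, §8 ("f_{2,1}(β₁,β₂,α) = F₄(α) − F₅(β₁,β₂)")] -/
theorem family_two_eq_0164 {F₀ : VecFn}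
    (hsupp : ∀ (k : ℕ) (ξ : Fin k → ℝ), F₀ k ξ ≠ 0 → (∀ i, (41 / 250 : ℝ) ≤ ξ i) ∧ ∑ i, ξ i = 1)
    (h6 : ∀ x : Fin 6 → ℝ, F₀ 6 x = 0) (α : ℝ) (b : Fin 2 → ℝ) :
    ∑ n ∈ Finset.Icc 2 6, sliceIntegral n α (fun v => if ∀ t, (41 / 250 : ℝ) ≤ v t then
        blockWeight (1 / 2) n v * F₀ (n + 2) (Fin.append v b) else 0) =
      sliceIntegral 2 α (fun v => if ∀ t, (41 / 250 : ℝ) ≤ v t then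
          blockWeight (1 / 2) 2 v * F₀ (2 + 2) (Fin.append v b) else 0) +
        sliceIntegral 3 α (fun v => if ∀ t, (41 / 250 : ℝ) ≤ v t then
          blockWeight (1 / 2) 3 v * F₀ (3 + 2) (Fin.append v b) else 0) := by
  rw [show Finset.Icc 2 6 = {2, 3, 4, 5, 6} from by decide, Finset.sum_insert (by decide),
    Finset.sum_insert (by decide), Finset.sum_insert (by decide), Finset.sum_pair (by decide),
    sliceIntegral_family_term_eq_zero α b (show 4 + 2 = 6 from rfl) h6,
    sliceIntegral_family_term_eq_zero α b (show 5 + 2 = 7 from rfl)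
      (fun x => apply_eq_zero_of_seven_le_0164 hsupp (le_refl 7) x),
    sliceIntegral_family_term_eq_zero α b (show 6 + 2 = 8 from rfl)
      (fun x => apply_eq_zero_of_seven_le_0164 hsupp (by norm_num) x)]
  ring

/-- **On `Δ₂(α)` with `α ≥ 1/2` the two-piece weight at `γ = 1/2` is `≤ 0`**: it is `-1/(2v₀v₁)` when both
pieces are `< 1/2` and `0` otherwise (Lemma 5.5 (a)).
[cite: FordMaynard2024PrimeSieves, §8 ("if k = 2 then 𝓛_{1/2}(u) = −1") and Lemma 5.5 (a)] -/
theorem blockWeight_half_two_nonpos_of_ge (v : Fin 2 → ℝ) (hpos : ∀ i, 0 < v i) {α : ℝ}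
    (hs : ∑ i, v i = α) (hα : 1 / 2 ≤ α) : blockWeight (1 / 2) 2 v ≤ 0 := by
  rw [Fin.sum_univ_two] at hs
  have h0 := hpos 0
  have h1 := hpos 1
  by_cases hv0 : v 0 < 1 / 2
  · by_cases hv1 : v 1 < 1 / 2
    · rw [blockWeight_two_eq v (by linarith) (by linarith) (by linarith)]
      exact div_nonpos_of_nonpos_of_nonneg (by norm_num) (by positivity)
    · unfold blockWeight
      rw [linnikFn_eq_zero_of_mem (1 - 1 / 2) v (Finset.mem_univ 1) (by push Not at hv1; linarith)
        fun k _ => (hpos k).le, zero_div]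
  · unfold blockWeight
    rw [linnikFn_eq_zero_of_mem (1 - 1 / 2) v (Finset.mem_univ 0) (by push Not at hv0; linarith)
      fun k _ => (hpos k).le, zero_div]

/-- **The `n = 2` piece of a family is `≥ 0` when the data are `≤ 0`** in the relevant dimension
(`w₂ ≤ 0` on `Δ₂(α)`, `α ≥ 1/2`): Ford–Maynard's `F₃(α) ≥ 0` (`s = 1`, `F₀⁽³⁾ = -𝟙`) and `F₄(α) ≥ 0`
(`s = 2`, `F₀⁽⁴⁾ = -𝟙`). [cite: FordMaynard2024PrimeSieves, §8 (proof of Theorem 2.7 (c))] -/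
theorem piece_two_nonneg_0164 {F₀ : VecFn} {s : ℕ} (hle : ∀ x : Fin (2 + s) → ℝ, F₀ (2 + s) x ≤ 0)
    {α : ℝ} (hα : 1 / 2 ≤ α) (b : Fin s → ℝ) :
    0 ≤ sliceIntegral 2 α (fun v => if ∀ t, (41 / 250 : ℝ) ≤ v t then
      blockWeight (1 / 2) 2 v * F₀ (2 + s) (Fin.append v b) else 0) := by
  refine sliceIntegral_nonneg_of _ _ _ fun v hv hvs => ?_
  split_ifs
  · exact mul_nonneg_of_nonpos_of_nonpos (blockWeight_half_two_nonpos_of_ge v hv hvs hα) (hle _)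
  · exact le_rfl

/-- **The `n = 4` piece of `f_{1,1}` is `≥ 0`**: for `F₀⁽⁵⁾ ≥ 0` vanishing at vectors with a pair summing to
`≥ 1/2`, at a four-piece fragmentation `u` of `α` with `F₀⁽⁵⁾(u, 1 - α) ≠ 0` all pairs of `u` are `< 1/2` and
all triples are `> 1/2` (each `u_l < α - 1/2`), so `𝓛_{1/2}(u) = 3` and `w₄(u) = 1/(8 ∏ u) > 0`.
[cite: FordMaynard2024PrimeSieves, §8 ("if k = 4 and f_{5,0}(1−α,u) ≠ 0 then 𝓛_{1/2}(u) = 3")] -/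
theorem piece_four_nonneg_0164 {F₀ : VecFn} (h5 : ∀ x : Fin 5 → ℝ, 0 ≤ F₀ 5 x)
    (hpair : ∀ (x : Fin 5 → ℝ) (i j : Fin 5), i ≠ j → 1 / 2 ≤ x i + x j → F₀ 5 x = 0)
    (α : ℝ) (b : Fin 1 → ℝ) (hb : ∑ i, b i = 1 - α) :
    0 ≤ sliceIntegral 4 α (fun v => if ∀ t, (41 / 250 : ℝ) ≤ v t then
      blockWeight (1 / 2) 4 v * F₀ (4 + 1) (Fin.append v b) else 0) := by
  rw [Fin.sum_univ_one] at hb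
  refine sliceIntegral_nonneg_of _ _ _ fun v hv hvs => ?_
  split_ifs with hc
  · by_cases hz : F₀ (4 + 1) (Fin.append v b) = 0
    · rw [hz, mul_zero]
    · -- no pair of `(v, b)` sums to `≥ 1/2`
      have hp : ∀ i j : Fin 5, i ≠ j → Fin.append v b i + Fin.append v b j < 1 / 2 := by
        intro i j hij
        by_contra h
        exact hz (hpair _ i j hij (not_lt.1 h))
      have hvv : ∀ i j : Fin 4, i ≠ j → v i + v j < 1 - 1 / 2 := by
        intro i j hij
        have := hp (Fin.castAdd 1 i) (Fin.castAdd 1 j) (fun h => hij (Fin.castAdd_inj.1 h))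
        rw [Fin.append_left, Fin.append_left] at this
        linarith
      have hvb : ∀ i : Fin 4, v i < α - 1 / 2 := by
        intro i
        have hi4 := i.isLt
        have := hp (Fin.castAdd 1 i) (Fin.natAdd 4 (0 : Fin 1)) (by
          intro h; have := congrArg Fin.val h; simp at this; omega)
        rw [Fin.append_left, Fin.append_right, hb] at this
        linarith
      rw [Fin.sum_univ_four] at hvs
      have ht : ∀ i j k : Fin 4, i ≠ j → i ≠ k → j ≠ k → 1 - 1 / 2 ≤ v i + v j + v k := by
        intro i j k hij hik hjk
        -- the complementary index `l`: `v i + v j + v k = α - v l > 1/2`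
        have h0 := hvb 0; have h1 := hvb 1; have h2 := hvb 2; have h3 := hvb 3
        fin_cases i <;> fin_cases j <;> fin_cases k <;> simp at hij hik hjk ⊢ <;> linarith
      rw [blockWeight_four_eq v hvv ht]
      have h0 := hv 0; have h1 := hv 1; have h2 := hv 2; have h3 := hv 3
      exact mul_nonneg (by positivity) (h5 _)
  · exact le_rfl

/-- **Hypothesis (ii) from the shape**: data with `F₀⁽³⁾, F₀⁽⁴⁾ ≥ -1`, `F₀⁽⁵⁾ ≥ 0`, `F₀⁽⁶⁾ = 0`, supported on
`{ξᵢ ≥ 41/250, Σ ξ = 1}`, are `≥ -1` at every small vector of the support (small vectors summing to `1` live in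
dimensions `3, …, 6` only). [cite: FordMaynard2024PrimeSieves, §8 (proof of Theorem 2.7 (c))] -/
theorem hsmall_of_shape_0164 {F₀ : VecFn}
    (hsupp : ∀ (k : ℕ) (ξ : Fin k → ℝ), F₀ k ξ ≠ 0 → (∀ i, (41 / 250 : ℝ) ≤ ξ i) ∧ ∑ i, ξ i = 1)
    (h3 : ∀ x : Fin 3 → ℝ, -1 ≤ F₀ 3 x) (h4 : ∀ x : Fin 4 → ℝ, -1 ≤ F₀ 4 x)
    (h5 : ∀ x : Fin 5 → ℝ, 0 ≤ F₀ 5 x) (h6 : ∀ x : Fin 6 → ℝ, F₀ 6 x = 0) :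
    ∀ (k : ℕ) (ξ : Fin k → ℝ), (∀ i, (41 / 250 : ℝ) ≤ ξ i) → (∀ i, ξ i < 1 / 2) →
      ∑ i, ξ i = 1 → -1 ≤ F₀ k ξ := by
  intro k ξ hξ hlt hsum
  by_cases h7 : 7 ≤ k
  · rw [apply_eq_zero_of_seven_le_0164 hsupp h7 ξ]; norm_num
  · have hk3 : 3 ≤ k := by
      by_contra hk
      have hle : ∑ i, ξ i ≤ ∑ _i : Fin k, (1 / 2 : ℝ) := Finset.sum_le_sum fun i _ => (hlt i).le
      have hlt' : k = 0 ∨ ∑ i, ξ i < ∑ _i : Fin k, (1 / 2 : ℝ) := by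
        rcases Nat.eq_zero_or_pos k with h0 | hpos
        · exact Or.inl h0
        · exact Or.inr (Finset.sum_lt_sum_of_nonempty
            (Finset.univ_nonempty_iff.2 ⟨⟨0, hpos⟩⟩) fun i _ => hlt i)
      simp only [Finset.sum_const, Finset.card_univ, Fintype.card_fin, nsmul_eq_mul] at hle hlt'
      rcases hlt' with h0 | h
      · subst h0; simp at hsum
      · have hk' : (k : ℝ) ≤ 2 := by exact_mod_cast (by omega : k ≤ 2)
        linarith
    interval_cases k
    · exact h3 ξ
    · exact h4 ξ
    · linarith [h5 ξ]
    · rw [h6 ξ]; norm_num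

/-- **`stub_tweakNeg0164` from the shape and three numerical inequalities.** Let `F₀ ∈ 𝒮` be piecewise
Lipschitz in each dimension, supported on `{ξᵢ ≥ 41/250, Σ ξ = 1}`, with `F₀⁽³⁾, F₀⁽⁴⁾ ∈ [-1, 0]`, `F₀⁽⁵⁾ ≥ 0`
vanishing at vectors with a pair summing to `≥ 1/2`, and `F₀⁽⁶⁾ = 0`. If
(i) `T₃(F₀) + S₅(F₀) < -1`;
(iv₁) for every `b ∈ [41/250, 1/2)^1`, with `α = 1 - b₀`: `α (N₂ + N₃) ≥ -1`, `N₂, N₃` the two- and three-piece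
terms of `f_{1,1}` (the four-piece term being `≥ 0`, `piece_four_nonneg_0164`);
(iv₂) for every `b ∈ [41/250, 1/2)^2` with `|b| ≤ 1/2`, `α = 1 - |b|`: `α (A + B) ≥ -1`, `A, B` the two- and
three-piece terms of `f_{2,1}`;
then `F₀` witnesses `stub_tweakNeg0164` (statement verbatim): hypotheses (ii), (iii) and the families with
`s ≥ 3` are discharged by `hsmall_of_shape_0164`, `hhalf_0164`, `families_high_eq_zero_0164`.
[cite: FordMaynard2024PrimeSieves, §8 (proof of Theorem 2.7 (c))] -/
theorem stub_tweakNeg0164_of_shape' (F₀ : VecFn) (hs : F₀.IsSymmetric)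
    (hpl : ∀ k, IsPiecewiseLipschitz (F₀ k))
    (hsupp : ∀ (k : ℕ) (ξ : Fin k → ℝ), F₀ k ξ ≠ 0 → (∀ i, (41 / 250 : ℝ) ≤ ξ i) ∧ ∑ i, ξ i = 1)
    (h3 : ∀ x : Fin 3 → ℝ, -1 ≤ F₀ 3 x ∧ F₀ 3 x ≤ 0) (h4 : ∀ x : Fin 4 → ℝ, -1 ≤ F₀ 4 x ∧ F₀ 4 x ≤ 0)
    (h5 : ∀ x : Fin 5 → ℝ, 0 ≤ F₀ 5 x)
    (hpair : ∀ (x : Fin 5 → ℝ) (i j : Fin 5), i ≠ j → 1 / 2 ≤ x i + x j → F₀ 5 x = 0)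
    (h6 : ∀ x : Fin 6 → ℝ, F₀ 6 x = 0)
    (hone : sliceIntegral 3 1 (fun v => if (∀ t, (41 / 250 : ℝ) ≤ v t) ∧ (∀ t, v t < 1 / 2) then
          F₀ 3 v / (3 * (v 0 * v 1 * v 2)) else 0) +
        sliceIntegral 5 1
          (fun v => if ∀ t, (41 / 250 : ℝ) ≤ v t then blockWeight (1 / 2) 5 v * F₀ 5 v else 0) < -1)
    (h1 : ∀ b : Fin 1 → ℝ, (∀ i, (41 / 250 : ℝ) ≤ b i) → (∀ i, b i < 1 / 2) →
      -1 ≤ (1 - ∑ i, b i) *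
        (sliceIntegral 2 (1 - ∑ i, b i) (fun v => if ∀ t, (41 / 250 : ℝ) ≤ v t then
            blockWeight (1 / 2) 2 v * F₀ (2 + 1) (Fin.append v b) else 0) +
          sliceIntegral 3 (1 - ∑ i, b i) (fun v => if ∀ t, (41 / 250 : ℝ) ≤ v t then
            blockWeight (1 / 2) 3 v * F₀ (3 + 1) (Fin.append v b) else 0)))
    (h2 : ∀ b : Fin 2 → ℝ, (∀ i, (41 / 250 : ℝ) ≤ b i) → (∀ i, b i < 1 / 2) → ∑ i, b i ≤ 1 / 2 →
      -1 ≤ (1 - ∑ i, b i) *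
        (sliceIntegral 2 (1 - ∑ i, b i) (fun v => if ∀ t, (41 / 250 : ℝ) ≤ v t then
            blockWeight (1 / 2) 2 v * F₀ (2 + 2) (Fin.append v b) else 0) +
          sliceIntegral 3 (1 - ∑ i, b i) (fun v => if ∀ t, (41 / 250 : ℝ) ≤ v t then
            blockWeight (1 / 2) 3 v * F₀ (3 + 2) (Fin.append v b) else 0))) :
    ∃ F₀ : VecFn, F₀.IsSymmetric ∧ (∀ k, IsPiecewiseLipschitz (F₀ k)) ∧
      (∀ (k : ℕ) (ξ : Fin k → ℝ), F₀ k ξ ≠ 0 → (∀ i, (41 / 250 : ℝ) ≤ ξ i) ∧ ∑ i, ξ i = 1) ∧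
      tweak (1 / 2) (41 / 250) Fin.elim0 Fin.elim0 F₀ 1 (fun _ => 1) < -1 ∧
      ∀ k : ℕ, 2 ≤ k → ∀ β : Fin k → ℝ, -1 ≤ tweak (1 / 2) (41 / 250) Fin.elim0 Fin.elim0 F₀ k β := by
  refine stub_tweakNeg0164_of_shape F₀ hs hpl hsupp hpair h6 hone
    (hsmall_of_shape_0164 hsupp (fun x => (h3 x).1) (fun x => (h4 x).1) h5 h6)
    (hhalf_0164 hpl hsupp (fun x => (h4 x).1) h5 h6) (fun b hb hb' hbs => ?_) (fun b hb hb' hbs => ?_)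
  · rw [family_one_eq_0164 hsupp h6]
    have hα : 1 / 2 ≤ 1 - ∑ i, b i := by linarith
    have hN4 := piece_four_nonneg_0164 h5 hpair (1 - ∑ i, b i) b (by ring)
    have hmain := h1 b hb hb'
    have hα0 : 0 ≤ 1 - ∑ i, b i := by linarith
    nlinarith
  · rw [family_two_eq_0164 hsupp h6]
    exact h2 b hb hb' hbs

end Summit.Parity.GeneralizedHardyLittlewood.FordMaynardNoSieveConst0164NegWitness0164

end
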